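import Summits.QuantumFields.BalabanUV.Beta.GAN24.StencilSlotRowsMerge
import Summits.QuantumFields.BalabanUV.Beta.GAN24.TaylorRowW
import Summits.QuantumFields.BalabanUV.Beta.GAN24.S3RowV0
import Summits.QuantumFields.BalabanUV.Beta.GAN24.S3ShapeL0
import Summits.QuantumFields.BalabanUV.Beta.GAN24.S3ShapeVt
import Summits.QuantumFields.BalabanUV.Beta.GAN24.TaylorRowLamTop
import Summits.QuantumFields.BalabanUV.Beta.GAN24.TaylorRowV
import Summits.QuantumFields.BalabanUV.Beta.GAN24.TaylorRowLam

/-!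
# `BalabanUV.Beta.GAN24.StencilSlotSThree` — binder row G-an2-4 / (CONV-C), S-slot, road «S3»: «E3Shape» AND THE WALL's NON-CAUCHY S-ROW `hS`
# ARE UNCONDITIONAL AT `d = 3`, `Lc ≥ 2` (row owner b2b-balaban-gan24-p1, gen 4)

NOT IN PRINT; OUR PROOF ATTEMPT.  HONEST FRAMING (cell contract, verbatim): «discharging `BetaPertH` makes Bałaban's UV stability
UNCONDITIONAL — a real constructive-QFT result; it is NOT the continuum limit and NOT the Clay problem.»  HONEST DEPENDENCY (verbatim):
«continuum YM on T⁴ ⇐ BetaPertH ∧ nine spine estimates (0/9 proved); BetaPertH ⇐ (D1) ∧ (D4) ∧ CAP+tail; G-an2-4 gates asym, D1 and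
NE2/3/4.»

WHAT.  The located shape «E3Shape» of the S-slot — `∀ j, LocStencil (unitS (sfStep Lc (j+1)) (smStep 3 Lc (j+1)) ((cE·wE 3 Lc (j+1)) • e3Of 3 Lc
cE cVH cΛ (j+1))) C₃ δ₃` for some `C₃`, `δ₃ > 0` — and, from it, the wall's non-Cauchy S-row
`hS : ∃ Cs δS, 0 < δS ∧ ∀ j, LocStencil (unitS (sfStep Lc j) (smStep 3 Lc j) (JsBal0Of … j).S) Cs δS` for the Bałaban jets, with NO
hypothesis beyond `2 ≤ Lc` and an2's W-slot DATA `(W, Cw, δw, hδw, hW')` (which only NAME the jets; nothing about `W` is used).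

HOW ([folklore] composition, every input BY NAME).  The seven SHAPE rows of road «S3» are tree theorems at `d = 3`, landed by seven seats
of the G-an2-4 formalisation swarm on the row owner's kernel table `StencilSlotE3OfPieces.e3Shape_of_pieces` (p206983):
* W  `TaylorRowW.rowW_three` (leaf-19; Wilson row, the one cancellation `WilsonVertexSumZero`),
* V0 `S3RowV0.shapeV0` (leaf-09; level-0 (V-H) piece, `θ = Lc⁻¹`),
* Λ0 `S3ShapeL0.rowL0_shape` (leaf-08; level-0 Λ piece),
* Vt `S3ShapeVt.shapeVt_three` (leaf-12; top border increment; K-slot twin `TopBorderKSlot.shapeVt_three`, leaf-05),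
* Λt `TaylorRowLamTop.rowLamTop` (leaf-10; top Lagrange increment),
* V  `TaylorRowV.rowV_three` (leaf-14; levels `m+1`, `m < n`, (V-H)),
* Λ  `TaylorRowLam.rowL_three` (leaf-18; levels `m+1`, `m < n`, Λ, `θ = Lc⁻¹`),
on the legs `StencilSlotE3PhiLeg` ∕ `StencilSlotE3HLeg` (K-slot `FibreStrip.unitDecayK_holds`, (N1) `FineReadoutDecay`), merged to common scalars by
`StencilSlotRowsMerge.shapeRows_merge`, fed to `e3Shape_of_pieces`, then `StencilSlotOfE3.hS_of_e3` (K-slot `KSlotAssembly.convCKWall_holds` inside).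

HONEST: this discharges the wall's `hS` (one of an2's four binder families `hS hSall hW hWall` of `HessKerConvCKPlug.d1Drift_JsBalOf_iff_of_convCKWall`,
the K-families being tree theorems since gen 3) and «E3Shape»; it does NOT discharge `hSall` («E3SupRate»: five DIFFERENCE rows + (N1-Cauchy), in
flight), NOR (hW, hWall) (an2, road P4); NOT «S-slot closed», NOT «G-an2-4 closed»; NOT BetaPertH, NOT continuum, NOT Clay.
-/

noncomputable section

open Literature.MathematicalPhysics.QuantumFieldTheory
open Literature.MathematicalPhysics.QuantumFieldTheory.Balaban1983to89
open Literature.MathematicalPhysics.QuantumFieldTheory.Balaban1983to89.Beta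
open ExpKernelCalculus (MKer VertexFamily₂)
open OneStepResolventKernel (Fib LocStencil)
open BalabanStepJetsSucc (wE e3Of JsBal0Of)
open Summit.QuantumFields.BalabanUV.Beta.HessKerDressedUnits (unitS)
open Summit.QuantumFields.BalabanUV.Beta.GAN24.CombesThomas (sfStep smStep)
open Summit.QuantumFields.BalabanUV.Beta.GAN24.StencilSlotOfE3 (one_le_of_two_le hS_of_e3)
open Summit.QuantumFields.BalabanUV.Beta.GAN24.StencilSlotE3OfPieces (e3Shape_of_pieces)
open Summit.QuantumFields.BalabanUV.Beta.GAN24.StencilSlotRowsMerge (shapeRows_merge)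

namespace Summit.QuantumFields.BalabanUV.Beta.GAN24.StencilSlotSThree

/-- `0 ≤ Lc⁻¹` and `Lc⁻¹ < 1` for `2 ≤ Lc` — the ratio of the two `θ = Lc⁻¹` rows (V0, Λ). [folklore] -/
theorem inv_Lc_ratio {Lc : ℕ} (hLc : 2 ≤ Lc) : 0 ≤ (Lc : ℝ)⁻¹ ∧ (Lc : ℝ)⁻¹ < 1 := by
  have h2 : (2 : ℝ) ≤ Lc := by exact_mod_cast hLc
  exact ⟨inv_nonneg.mpr (by linarith), inv_lt_one_of_one_lt₀ (by linarith)⟩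

variable {Lc : ℕ} [NeZero Lc]

/-- **«E3Shape» IS UNCONDITIONAL AT `d = 3`, `Lc ≥ 2`**: the normalised third jet of the Bałaban stencil, in the dressed units of the wall, is a
`LocStencil` family with ONE constant and ONE rate along the whole tower `j ≥ 1`.  The seven SHAPE rows by name, merged, into
`StencilSlotE3OfPieces.e3Shape_of_pieces`. [folklore] composition. -/
theorem e3Shape_three (hLc : 2 ≤ Lc) (cE cVH cΛ : ℝ) :
    ∃ C₃ δ₃ : ℝ, 0 < δ₃ ∧ ∀ j : ℕ, LocStencil (unitS (sfStep Lc (j + 1)) (smStep 3 Lc (j + 1))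
      (fun κ u => (cE * wE 3 Lc (j + 1)) • e3Of 3 Lc cE cVH cΛ (j + 1) κ u)) C₃ δ₃ := by
  have hLc1 : 1 ≤ Lc := one_le_of_two_le hLc
  obtain ⟨hι0, hι1⟩ := inv_Lc_ratio (Lc := Lc) hLc
  -- the seven rows, each repackaged as `∃ <scalars>, 0 < δ ∧ [0 ≤ θ ∧ θ < 1 ∧] ∀ …`
  obtain ⟨c₀V, δ₂, -, hδ₂, hV0⟩ := S3RowV0.shapeV0 (Lc := Lc) hLc1 cVH
  obtain ⟨c₀L, θ₃, δ₃, -, hθ₃0, hθ₃1, hδ₃, hL0⟩ := S3ShapeL0.rowL0_shape (Lc := Lc) hLc cΛ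
  obtain ⟨cV, θ₆, δ₆, -, hθ₆0, hθ₆1, hδ₆, hV⟩ := TaylorRowV.rowV_three (Lc := Lc) hLc cVH
  obtain ⟨cL, δ₇, hδ₇, hL⟩ := TaylorRowLam.rowL_three (Lc := Lc) cΛ
  obtain ⟨δ, θ, CW, c₀V', c₀L', CtV, CtL, cV', cL', hδ, hθ0, hθ1, h₁, h₂, h₃, h₄, h₅, h₆, h₇⟩ :=
    shapeRows_merge (d := 3) (TaylorRowW.rowW_three (Lc := Lc) cE) ⟨c₀V, (Lc : ℝ)⁻¹, δ₂, hδ₂, hι0, hι1, hV0⟩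
      ⟨c₀L, θ₃, δ₃, hδ₃, hθ₃0, hθ₃1, hL0⟩ (S3ShapeVt.shapeVt_three (Lc := Lc) hLc1 cVH) (TaylorRowLamTop.rowLamTop (Lc := Lc) hLc1 cΛ)
      ⟨cV, θ₆, δ₆, hδ₆, hθ₆0, hθ₆1, hV⟩ ⟨cL, (Lc : ℝ)⁻¹, δ₇, hδ₇, hι0, hι1, hL⟩
  exact e3Shape_of_pieces (d := 3) hLc1 cE cVH cΛ hδ hθ0 hθ1 h₁ h₂ h₃ h₄ h₅ h₆ h₇

/-- **THE WALL's NON-CAUCHY S-ROW `hS` IS UNCONDITIONAL AT `d = 3`, `Lc ≥ 2`**: for the Bałaban jets `JsBal0Of` (an2's W-slot data only NAME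
them), the dressed-unit stencil tables form a `LocStencil` family with one constant and one rate along the whole tower — the binder `hS` of
`HessKerConvCKPlug.d1Drift_JsBalOf_iff_of_convCKWall`, discharged.  `e3Shape_three` into `StencilSlotOfE3.hS_of_e3`. [folklore] composition. -/
theorem hS_three (hLc : 2 ≤ Lc) (cE cVH cΛ : ℝ)
    (W : ℕ → Fin (3 + 1) → (Fin (3 + 1) → ℤ) → Fin (3 + 1) → (Fin (3 + 1) → ℤ) → MKer (3 + 1) (Fib 3))
    (Cw δw : ℕ → ℝ) (hδw : ∀ j, 0 < δw j) (hW' : ∀ j, VertexFamily₂ (W j) Lc (Cw j) (δw j)) :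
    ∃ Cs δS : ℝ, 0 < δS ∧ ∀ j, LocStencil (unitS (sfStep Lc j) (smStep 3 Lc j)
      (JsBal0Of (one_le_of_two_le hLc) cE cVH cΛ W Cw δw hδw hW' j).S) Cs δS := by
  obtain ⟨C₃, δ₃, hδ₃, hE3⟩ := e3Shape_three (Lc := Lc) hLc cE cVH cΛ
  exact hS_of_e3 hLc hE3 hδ₃ W Cw δw hδw hW'

end Summit.QuantumFields.BalabanUV.Beta.GAN24.StencilSlotSThree

end
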